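import Summits.Parity.BatemanHorn.Theorems.SystemZeroRepulsion.Negative.StubRoughMajorantLoadBearing

/-!
# Stub S4 `stub_smoothPeriodicFactorisation` of line `smooth-rough-lattice-acquisition` — all four fields of `IsBatemanHornSystem` are load-bearing

Negative-side theorems (refuter, drefute gen 2, 2026-08-16) for the smooth THEOREM-stub S4 of the line
`Cruxes/SystemZeroRepulsion/Lines/smooth-rough-lattice-acquisition.lean` (skeleton sha 5e06eb842271) of the crux
`Summit.Parity.BatemanHorn.Theses.AlmostPrimeZeros.SystemZeroRepulsion` (stmt-Parity-11291); sequel to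
`StubRoughMajorantLoadBearing.lean` (stub S6), whose witnesses and rough-statistic lemmas are reused.

  S4  `∀ (k,f) BH, ∃ m₀ A C x₀, ∀ x ≥ x₀, ∀ z, ‖z−1‖ ≤ 3L → ∃ ι c, [∀ q ∈ ι, 0 < d_q ∣ Q] ∧
       (E) ‖S_x(z) − Σ_q c_q·ClassSum_x(m₀; d_q, a_q; z)‖ ≤ x(log x)^{k(Re z−1)} ∧
       (Λ) ‖Σ_q c_q/d_q‖ ≤ A·L₃^{k(Re z−1)}·e^{C‖z−1‖log(‖z−1‖+2)} ∧ (B) Σ_q ‖c_q‖/d_q ≤ L₃^{k(‖z‖−1)}·e^{C(‖z‖+1)}`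
  (`L = log log x`, `L₃ = log L`, `Q = ∏_{p≤⌊L⌋}p²`, `S_x(z) = Σ_{n≤x} z^{s_f(n)}`, class sums of the ROUGH statistic `s♯_x`).

For each field `H` we state S4 WITH `H` DROPPED (conclusion verbatim) and refute it at `z = −1` with the witnesses of the
S6 file: `![X^2]`, `![X, X]`, `![-X]`, `![C 3]`. Mechanism (`smooth_contradiction`, witness-independent): the full statistic
has constant parity, so `‖S_x(−1)‖ = x + 1`; the rough statistic is even (or zero, for `L ≥ 3`), so every class sum is a
COUNT `N_q = (x+1−m₀)/d_q + θ_q`, `|θ_q| ≤ 1` (`abs_card_filter_modEq_sub_le`, from Mathlib's `Nat.Ico_filter_modEq_card`);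
hence `x + 1 ≤ (E) + ‖Σ_q c_q N_q‖ ≤ x(log x)^{−2k} + Q·(B) + (x+1)·(Λ)` (`norm_sum_mul_card_le`, using `d_q ≤ Q`), while
`Q ≤ 16^{⌊L⌋} ≤ (log x)³` (`primesLE_sq_le_log_cube`, Mathlib's `primorial_le_four_pow`), `(B) = e^{2C}` and
`(Λ) = A·L₃^{−2k}·e^{2C log 4} → 0`: each of the three terms is eventually `≤ (x+1)/4` (`eventually_smooth_budget`).

What it says (nothing here bears on S4 for Bateman–Horn systems, for which the skeleton's CRT proof sketch stands): the
proof of S4 must consume `irreducible`/`pairwise_not_associated` — through the EXPONENT `k` in (Λ), i.e. through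
`Σ_{p≤t} ω_f(p)/p = k log log t + O(1)` (AZFG2020 / prime ideal theorem; for `X²`, `(X,X)` the smooth Euler product is
`∏_{p≤L}(1 + (z²−1)/p + …)` of modulus `≍ L₃^{Re z²−1}`) — `leadingCoeff_pos` through `m₀` (`Int.toNat`), and must exclude
constants (`hasNoFixedPrimeDivisor`). (The gen-1 drefute note "no BH hypothesis is used by S4" is wrong for the typed stub.)
-/

noncomputable section

open Filter Polynomial Finset
open scoped Topology

namespace Summit.Parity.BatemanHorn.Theorems.SystemZeroRepulsion.Negative

open Literature.NumberTheory.Sieve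
open Summit.Parity.BatemanHorn.Theorems.SystemLSDRealSegment.Negative

/-! ## Counting in residue classes; the squeeze -/

/-- `|#{n ∈ [m₀, x] : n ≡ a (d)} − (x+1−m₀)/d| ≤ 1` (`0 < d`; truncated subtraction, both sides vanish if `m₀ > x+1`). [folklore] -/
theorem abs_card_filter_modEq_sub_le (m₀ x a : ℕ) {d : ℕ} (hd : 0 < d) :
    |((((Finset.Ico m₀ (x + 1)).filter (fun n : ℕ => n ≡ a [MOD d])).card : ℕ) : ℝ) -
      ((x + 1 - m₀ : ℕ) : ℝ) / (d : ℝ)| ≤ 1 := by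
  rcases le_or_gt m₀ (x + 1) with hm | hm
  · have hcard := Nat.Ico_filter_modEq_card m₀ (x + 1) hd a
    have hd' : (0 : ℚ) < d := by exact_mod_cast hd
    set u : ℚ := (((x + 1 : ℕ) : ℚ) - a) / d with hu
    set v : ℚ := ((m₀ : ℚ) - a) / d with hv
    have huv : v ≤ u := by
      rw [hu, hv]
      gcongr
    have hmax : max (⌈u⌉ - ⌈v⌉) 0 = ⌈u⌉ - ⌈v⌉ :=
      max_eq_left (sub_nonneg.2 (Int.ceil_le_ceil huv))
    have hN : ((((Finset.Ico m₀ (x + 1)).filter (fun n : ℕ => n ≡ a [MOD d])).card : ℕ) : ℤ) = ⌈u⌉ - ⌈v⌉ := by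
      rw [← hmax, ← hcard]
    have hdiff : u - v = ((x + 1 - m₀ : ℕ) : ℚ) / d := by
      rw [hu, hv, Nat.cast_sub hm]
      push_cast
      ring
    have h1 : |((⌈u⌉ - ⌈v⌉ : ℤ) : ℚ) - (u - v)| ≤ 1 := by
      have hu1 := Int.le_ceil u
      have hu2 := Int.ceil_lt_add_one u
      have hv1 := Int.le_ceil v
      have hv2 := Int.ceil_lt_add_one v
      rw [abs_le]
      push_cast
      constructor <;> linarith
    rw [hdiff] at h1
    have h2 : |(((((Finset.Ico m₀ (x + 1)).filter (fun n : ℕ => n ≡ a [MOD d])).card : ℕ) : ℤ) : ℚ) -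
        ((x + 1 - m₀ : ℕ) : ℚ) / d| ≤ 1 := by rw [hN]; exact h1
    have h3 := (Rat.cast_le (K := ℝ)).2 h2
    push_cast at h3 ⊢
    simpa using h3
  · have hI : Finset.Ico m₀ (x + 1) = ∅ := Finset.Ico_eq_empty (by omega)
    simp [hI, Nat.sub_eq_zero_of_le hm.le]

/-- The squeeze: if `Σ‖c_q‖/d_q ≤ B`, `‖Σ c_q/d_q‖ ≤ Λ` and every `0 < d_q ∣ Q`, then
`‖Σ_q c_q · #{n ∈ [m₀,x] : n ≡ a_q (d_q)}‖ ≤ Q·B + (x+1−m₀)·Λ`. [folklore] -/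
theorem norm_sum_mul_card_le {ι : Finset (ℕ × ℕ)} {c : ℕ × ℕ → ℂ} {Q : ℕ} (hQ : 0 < Q)
    (hι : ∀ q ∈ ι, 0 < q.1 ∧ q.1 ∣ Q) (m₀ x : ℕ) {Λ B : ℝ}
    (hΛ : ‖∑ q ∈ ι, c q / (q.1 : ℂ)‖ ≤ Λ) (hB : ∑ q ∈ ι, ‖c q‖ / (q.1 : ℝ) ≤ B) :
    ‖∑ q ∈ ι, c q * ((((Finset.Ico m₀ (x + 1)).filter (fun n : ℕ => n ≡ q.2 [MOD q.1])).card : ℕ) : ℂ)‖ ≤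
      (Q : ℝ) * B + ((x + 1 - m₀ : ℕ) : ℝ) * Λ := by
  set X : ℝ := ((x + 1 - m₀ : ℕ) : ℝ) with hX
  have hX0 : 0 ≤ X := Nat.cast_nonneg _
  set N : ℕ × ℕ → ℝ := fun q =>
    ((((Finset.Ico m₀ (x + 1)).filter (fun n : ℕ => n ≡ q.2 [MOD q.1])).card : ℕ) : ℝ) with hNdef
  have hsplit : ∑ q ∈ ι, c q * ((((Finset.Ico m₀ (x + 1)).filter (fun n : ℕ => n ≡ q.2 [MOD q.1])).card : ℕ) : ℂ)
      = ∑ q ∈ ι, c q * ((N q - X / q.1 : ℝ) : ℂ) + (X : ℂ) * ∑ q ∈ ι, c q / (q.1 : ℂ) := by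
    rw [Finset.mul_sum, ← Finset.sum_add_distrib]
    refine Finset.sum_congr rfl fun q hq => ?_
    have hd : (q.1 : ℂ) ≠ 0 := by exact_mod_cast (hι q hq).1.ne'
    rw [hNdef]
    push_cast
    field_simp
    ring
  rw [hsplit]
  refine (norm_add_le _ _).trans (add_le_add ?_ ?_)
  · calc ‖∑ q ∈ ι, c q * ((N q - X / q.1 : ℝ) : ℂ)‖ ≤ ∑ q ∈ ι, ‖c q * ((N q - X / q.1 : ℝ) : ℂ)‖ := norm_sum_le _ _
      _ ≤ ∑ q ∈ ι, (Q : ℝ) * (‖c q‖ / (q.1 : ℝ)) := by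
          refine Finset.sum_le_sum fun q hq => ?_
          obtain ⟨hd0, hdQ⟩ := hι q hq
          have hd0' : (0 : ℝ) < q.1 := by exact_mod_cast hd0
          have hdQ' : (q.1 : ℝ) ≤ Q := by exact_mod_cast Nat.le_of_dvd hQ hdQ
          rw [norm_mul, Complex.norm_real, Real.norm_eq_abs]
          have h1 : |N q - X / q.1| ≤ 1 := abs_card_filter_modEq_sub_le m₀ x q.2 hd0
          calc ‖c q‖ * |N q - X / ↑q.1| ≤ ‖c q‖ * 1 := by gcongr
            _ = (q.1 : ℝ) * (‖c q‖ / (q.1 : ℝ)) := by field_simp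
            _ ≤ (Q : ℝ) * (‖c q‖ / (q.1 : ℝ)) := by gcongr
      _ = (Q : ℝ) * ∑ q ∈ ι, ‖c q‖ / (q.1 : ℝ) := by rw [Finset.mul_sum]
      _ ≤ (Q : ℝ) * B := by gcongr
  · rw [norm_mul, Complex.norm_real, Real.norm_eq_abs, abs_of_nonneg hX0]
    gcongr


/-! ### The smooth modulus `Q = ∏_{p ≤ ⌊L⌋} p²` is polylogarithmic -/

/-- `∏_{p ≤ n} p² = (n#)² ≤ 16^n`. [folklore] -/
theorem prod_primesLE_sq_le (n : ℕ) : (∏ p ∈ Nat.primesLE n, p ^ 2) ≤ 16 ^ n := by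
  have h1 : (∏ p ∈ Nat.primesLE n, p ^ 2) = (primorial n) ^ 2 := by
    rw [Finset.prod_pow]
    rfl
  rw [h1]
  calc (primorial n) ^ 2 ≤ (4 ^ n) ^ 2 := Nat.pow_le_pow_left (primorial_le_four_pow n) 2
    _ = 16 ^ n := by rw [← pow_mul, mul_comm, pow_mul]; norm_num

/-- For `log y ≥ 1`: `Q = ∏_{p ≤ ⌊log log y⌋} p² ≤ (log y)³` (as reals), since `16^{L} = e^{L log 16} ≤ e^{3L} = (log y)³`. [folklore] -/
theorem primesLE_sq_le_log_cube {y : ℝ} (hy : 1 ≤ Real.log y) :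
    ((∏ p ∈ Nat.primesLE ⌊Real.log (Real.log y)⌋₊, p ^ 2 : ℕ) : ℝ) ≤ Real.log y ^ 3 := by
  set L : ℝ := Real.log (Real.log y) with hL
  have hL0 : 0 ≤ L := Real.log_nonneg hy
  have hlog0 : 0 < Real.log y := by linarith
  calc ((∏ p ∈ Nat.primesLE ⌊L⌋₊, p ^ 2 : ℕ) : ℝ) ≤ ((16 ^ ⌊L⌋₊ : ℕ) : ℝ) := by
        exact_mod_cast prod_primesLE_sq_le ⌊L⌋₊
    _ = (16 : ℝ) ^ ((⌊L⌋₊ : ℕ) : ℝ) := by rw [Real.rpow_natCast]; push_cast; ring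
    _ ≤ (16 : ℝ) ^ L := Real.rpow_le_rpow_of_exponent_le (by norm_num) (Nat.floor_le hL0)
    _ = Real.exp (Real.log 16 * L) := by rw [Real.rpow_def_of_pos (by norm_num)]
    _ ≤ Real.exp (3 * L) := by
        refine Real.exp_le_exp.2 (mul_le_mul_of_nonneg_right ?_ hL0)
        have h16 : (16 : ℝ) ≤ Real.exp 3 := by
          have he : (2.7 : ℝ) ≤ Real.exp 1 := by have := Real.exp_one_gt_d9; linarith
          have : Real.exp 3 = Real.exp 1 ^ 3 := by rw [← Real.exp_nat_mul]; norm_num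
          rw [this]
          calc (16 : ℝ) ≤ (2.7 : ℝ) ^ 3 := by norm_num
            _ ≤ Real.exp 1 ^ 3 := pow_le_pow_left₀ (by norm_num) he 3
        calc Real.log 16 ≤ Real.log (Real.exp 3) := Real.log_le_log (by norm_num) h16
          _ = 3 := Real.log_exp 3
    _ = Real.log y ^ 3 := by
        rw [hL, show (3 : ℝ) * Real.log (Real.log y) = ((3 : ℕ) : ℝ) * Real.log (Real.log y) by norm_num,
          Real.exp_nat_mul, Real.exp_log hlog0]


/-! ### Eventual smallness of the three S4 budgets at `z = -1` -/

/-- `log log log x → +∞` along the naturals. [folklore] -/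
theorem tendsto_logloglog_atTop : Tendsto (fun x : ℕ => Real.log (Real.log (Real.log (x : ℝ)))) atTop atTop :=
  Real.tendsto_log_atTop.comp tendsto_loglog_atTop

/-- At `z = -1` all three right-hand sides of S4 are eventually `≤ (x+1)/4` against a left side `x+1`. [folklore] -/
theorem eventually_smooth_budget (A C : ℝ) {k : ℕ} (hk : 1 ≤ k) :
    ∀ᶠ x : ℕ in atTop, 3 ≤ Real.log (Real.log (x : ℝ)) ∧
      (x : ℝ) * Real.log (x : ℝ) ^ ((k : ℝ) * ((-1 : ℂ).re - 1)) ≤ ((x : ℝ) + 1) / 4 ∧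
      ((∏ p ∈ Nat.primesLE ⌊Real.log (Real.log (x : ℝ))⌋₊, p ^ 2 : ℕ) : ℝ) *
          (Real.log (Real.log (Real.log (x : ℝ))) ^ ((k : ℝ) * (‖(-1 : ℂ)‖ - 1)) * Real.exp (C * (‖(-1 : ℂ)‖ + 1))) ≤
        ((x : ℝ) + 1) / 4 ∧
      ((x : ℝ) + 1) * (A * Real.log (Real.log (Real.log (x : ℝ))) ^ ((k : ℝ) * ((-1 : ℂ).re - 1)) *
          Real.exp (C * ‖(-1 : ℂ) - 1‖ * Real.log (‖(-1 : ℂ) - 1‖ + 2))) ≤ ((x : ℝ) + 1) / 4 := by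
  have hre : ((-1 : ℂ).re - 1) = -2 := by norm_num
  have hnorm : (‖(-1 : ℂ)‖ - 1) = 0 := by simp
  set B' : ℝ := Real.exp (C * ‖(-1 : ℂ) - 1‖ * Real.log (‖(-1 : ℂ) - 1‖ + 2)) with hB'
  have hB'0 : 0 < B' := Real.exp_pos _
  set E : ℝ := Real.exp (C * (‖(-1 : ℂ)‖ + 1)) with hE
  have hE0 : 0 < E := Real.exp_pos _
  set M : ℝ := 4 * |A| * B' + 1 with hM
  have hM1 : 1 ≤ M := by
    have : (0 : ℝ) ≤ 4 * |A| * B' := by positivity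
    linarith
  have hk1 : (1 : ℝ) ≤ k := by exact_mod_cast hk
  have hlog3 : Tendsto (fun x : ℕ => Real.log (x : ℝ) ^ 3 / (1 * (x : ℝ) + 0)) atTop (𝓝 0) :=
    (Real.tendsto_pow_log_div_mul_add_atTop 1 0 3 one_ne_zero).comp tendsto_natCast_atTop_atTop
  have hε : (0 : ℝ) < 1 / (4 * E) := by positivity
  filter_upwards [tendsto_loglog_atTop.eventually (eventually_ge_atTop 3),
    (Real.tendsto_log_atTop.comp tendsto_natCast_atTop_atTop).eventually (eventually_ge_atTop 4),
    tendsto_logloglog_atTop.eventually (eventually_ge_atTop M),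
    (tendsto_order.1 hlog3).2 _ hε, eventually_ge_atTop 1] with x hL3 hlog4 hL₃ hsmall hx1
  have hx0 : (0 : ℝ) < x := by exact_mod_cast hx1
  have hlog4' : (4 : ℝ) ≤ Real.log (x : ℝ) := hlog4
  have hlog1 : (1 : ℝ) ≤ Real.log (x : ℝ) := by linarith
  refine ⟨hL3, ?_, ?_, ?_⟩
  · -- (log x)^{-2k} ≤ (log x)^{-1} ≤ 1/4
    have h1 : Real.log (x : ℝ) ^ ((k : ℝ) * ((-1 : ℂ).re - 1)) ≤ (Real.log (x : ℝ))⁻¹ := by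
      rw [hre, ← Real.rpow_neg_one]
      exact Real.rpow_le_rpow_of_exponent_le hlog1 (by nlinarith)
    have h2 : (Real.log (x : ℝ))⁻¹ ≤ 1 / 4 := by
      rw [inv_eq_one_div, div_le_div_iff₀ (by linarith) (by norm_num)]; linarith
    calc (x : ℝ) * Real.log (x : ℝ) ^ ((k : ℝ) * ((-1 : ℂ).re - 1)) ≤ (x : ℝ) * (1 / 4) := by
          gcongr; exact h1.trans h2
      _ ≤ ((x : ℝ) + 1) / 4 := by linarith
  · -- Q ≤ (log x)^3 ≤ x/(4E)
    rw [hnorm, mul_zero, Real.rpow_zero, one_mul]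
    have hQ := primesLE_sq_le_log_cube (y := (x : ℝ)) hlog1
    have h3 : Real.log (x : ℝ) ^ 3 ≤ (x : ℝ) / (4 * E) := by
      have := hsmall.le
      rw [one_mul, add_zero, div_le_iff₀ hx0] at this
      rw [le_div_iff₀ (by positivity)]
      calc Real.log (x : ℝ) ^ 3 * (4 * E) = Real.log (x : ℝ) ^ 3 * 4 * E := by ring
        _ ≤ 1 / (4 * E) * x * 4 * E := by gcongr
        _ = x := by field_simp
    calc ((∏ p ∈ Nat.primesLE ⌊Real.log (Real.log (x : ℝ))⌋₊, p ^ 2 : ℕ) : ℝ) * E ≤ (x : ℝ) / (4 * E) * E := by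
          gcongr; exact hQ.trans h3
      _ = (x : ℝ) / 4 := by field_simp
      _ ≤ ((x : ℝ) + 1) / 4 := by linarith
  · -- A L₃^{-2k} B' ≤ |A| B' / M ≤ 1/4
    have hL₃1 : 1 ≤ Real.log (Real.log (Real.log (x : ℝ))) := hM1.trans hL₃
    have h1 : Real.log (Real.log (Real.log (x : ℝ))) ^ ((k : ℝ) * ((-1 : ℂ).re - 1)) ≤ M⁻¹ := by
      rw [hre]
      calc Real.log (Real.log (Real.log (x : ℝ))) ^ ((k : ℝ) * -2)
          ≤ Real.log (Real.log (Real.log (x : ℝ))) ^ (-1 : ℝ) :=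
            Real.rpow_le_rpow_of_exponent_le hL₃1 (by nlinarith)
        _ = (Real.log (Real.log (Real.log (x : ℝ))))⁻¹ := Real.rpow_neg_one _
        _ ≤ M⁻¹ := inv_anti₀ (by linarith) hL₃
    have h0 : 0 ≤ Real.log (Real.log (Real.log (x : ℝ))) ^ ((k : ℝ) * ((-1 : ℂ).re - 1)) :=
      Real.rpow_nonneg (by linarith) _
    have h2 : A * Real.log (Real.log (Real.log (x : ℝ))) ^ ((k : ℝ) * ((-1 : ℂ).re - 1)) * B' ≤ 1 / 4 := by
      calc A * Real.log (Real.log (Real.log (x : ℝ))) ^ ((k : ℝ) * ((-1 : ℂ).re - 1)) * B'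
          ≤ |A| * Real.log (Real.log (Real.log (x : ℝ))) ^ ((k : ℝ) * ((-1 : ℂ).re - 1)) * B' :=
            mul_le_mul_of_nonneg_right (mul_le_mul_of_nonneg_right (le_abs_self A) h0) hB'0.le
        _ ≤ |A| * M⁻¹ * B' :=
            mul_le_mul_of_nonneg_right (mul_le_mul_of_nonneg_left h1 (abs_nonneg A)) hB'0.le
        _ = |A| * B' / M := by ring
        _ ≤ 1 / 4 := by
            rw [div_le_iff₀ (by linarith)]
            nlinarith [abs_nonneg A]
    have hx1' : (0 : ℝ) ≤ (x : ℝ) + 1 := by linarith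
    calc ((x : ℝ) + 1) * (A * Real.log (Real.log (Real.log (x : ℝ))) ^ ((k : ℝ) * ((-1 : ℂ).re - 1)) * B')
        ≤ ((x : ℝ) + 1) * (1 / 4) := by gcongr
      _ = ((x : ℝ) + 1) / 4 := by ring


/-! ### Evaluation of the sums at `z = -1` and the witness-independent contradiction -/

/-- A sum of `(-1)^{e(n)}` with every `e(n)` even is the number of terms. [folklore] -/
theorem sum_neg_one_pow_eq_card {e : ℕ → ℕ} (he : ∀ n, 2 ∣ e n) (s : Finset ℕ) :
    ∑ n ∈ s, (-1 : ℂ) ^ (e n) = (s.card : ℂ) := by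
  rw [Finset.sum_congr rfl fun n _ => Even.neg_one_pow (even_iff_two_dvd.2 (he n)), Finset.sum_const,
    nsmul_eq_mul, mul_one]

/-- A sum over `range (x+1)` of a constant unimodular term has norm `x + 1`. [folklore] -/
theorem norm_sum_range_const {g : ℕ → ℂ} {ε : ℂ} (hε : ‖ε‖ = 1) (hg : ∀ n, g n = ε) (x : ℕ) :
    ‖∑ n ∈ Finset.range (x + 1), g n‖ = (x : ℝ) + 1 := by
  rw [Finset.sum_congr rfl fun n _ => hg n, Finset.sum_const, Finset.card_range, nsmul_eq_mul, norm_mul, hε,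
    mul_one, Complex.norm_natCast]
  push_cast
  ring

/-- WITNESS-INDEPENDENT CONTRADICTION. If the full statistic has constant parity (`(-1)^{s_f(n)} = ε`, `|ε| = 1`)
and the rough statistic is even once `log log x ≥ 3`, then the conclusion of S4 (for this `k ≥ 1`, `m₀, A, C, x₀`)
is contradictory: at `z = -1` the left side of (E) is `x + 1` up to the class-sum term, which (Λ), (B) and
`d ≤ Q ≤ (log x)³` squeeze below `(x+1)/2`. [folklore] -/
theorem smooth_contradiction {k : ℕ} (hk : 1 ≤ k) {m₀ : ℕ} {A C : ℝ} {x₀ : ℕ}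
    {full : ℕ → ℕ} {rough : ℕ → ℕ → ℕ}
    (hS4 : ∀ x : ℕ, x₀ ≤ x → ∀ z : ℂ, ‖z - 1‖ ≤ 3 * Real.log (Real.log (x : ℝ)) →
        ∃ (ι : Finset (ℕ × ℕ)) (c : ℕ × ℕ → ℂ),
          (∀ q ∈ ι, 0 < q.1 ∧ q.1 ∣ (∏ p ∈ Nat.primesLE ⌊Real.log (Real.log (x : ℝ))⌋₊, p ^ 2)) ∧
          ‖(∑ n ∈ Finset.range (x + 1), (z : ℂ) ^ (full n)) -
              ∑ q ∈ ι, c q * (∑ n ∈ (Finset.Ico m₀ (x + 1)).filter (fun n : ℕ => n ≡ q.2 [MOD q.1]),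
                (z : ℂ) ^ (rough x n))‖ ≤
            (x : ℝ) * (Real.log (x : ℝ)) ^ ((k : ℝ) * (z.re - 1)) ∧
          ‖∑ q ∈ ι, c q / (q.1 : ℂ)‖ ≤
            A * (Real.log (Real.log (Real.log (x : ℝ)))) ^ ((k : ℝ) * (z.re - 1)) *
              Real.exp (C * ‖(z : ℂ) - 1‖ * Real.log (‖(z : ℂ) - 1‖ + 2)) ∧
          ∑ q ∈ ι, ‖c q‖ / (q.1 : ℝ) ≤
            (Real.log (Real.log (Real.log (x : ℝ)))) ^ ((k : ℝ) * (‖z‖ - 1)) * Real.exp (C * (‖z‖ + 1)))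
    {ε : ℂ} (hε : ‖ε‖ = 1) (hfull : ∀ n, (-1 : ℂ) ^ (full n) = ε)
    (hrough : ∀ x : ℕ, 3 ≤ Real.log (Real.log (x : ℝ)) → ∀ n, 2 ∣ rough x n) : False := by
  obtain ⟨x, ⟨hL3, h3, h4, h5⟩, hx⟩ := ((eventually_smooth_budget A C hk).and (eventually_ge_atTop x₀)).exists
  have hdisc : ‖(-1 : ℂ) - 1‖ ≤ 3 * Real.log (Real.log (x : ℝ)) := by
    have : ‖(-1 : ℂ) - 1‖ = 2 := by norm_num
    linarith
  obtain ⟨ι, c, hι, hE, hΛ, hB⟩ := hS4 x hx (-1) hdisc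
  have hSnorm : ‖∑ n ∈ Finset.range (x + 1), (-1 : ℂ) ^ (full n)‖ = (x : ℝ) + 1 :=
    norm_sum_range_const hε hfull x
  have hT : ∑ q ∈ ι, c q * (∑ n ∈ (Finset.Ico m₀ (x + 1)).filter (fun n : ℕ => n ≡ q.2 [MOD q.1]),
        (-1 : ℂ) ^ (rough x n))
      = ∑ q ∈ ι, c q * ((((Finset.Ico m₀ (x + 1)).filter (fun n : ℕ => n ≡ q.2 [MOD q.1])).card : ℕ) : ℂ) :=
    Finset.sum_congr rfl fun q _ => by rw [sum_neg_one_pow_eq_card (hrough x hL3)]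
  rw [hT] at hE
  have hQ0 : 0 < ∏ p ∈ Nat.primesLE ⌊Real.log (Real.log (x : ℝ))⌋₊, p ^ 2 :=
    Finset.prod_pos fun p hp => pow_pos (Nat.prime_of_mem_primesLE hp).pos 2
  have hsq := norm_sum_mul_card_le hQ0 hι m₀ x hΛ hB
  have htri' := norm_add_le ((∑ n ∈ Finset.range (x + 1), (-1 : ℂ) ^ (full n)) -
      ∑ q ∈ ι, c q * ((((Finset.Ico m₀ (x + 1)).filter (fun n : ℕ => n ≡ q.2 [MOD q.1])).card : ℕ) : ℂ))
    (∑ q ∈ ι, c q * ((((Finset.Ico m₀ (x + 1)).filter (fun n : ℕ => n ≡ q.2 [MOD q.1])).card : ℕ) : ℂ))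
  rw [sub_add_cancel, hSnorm] at htri'
  have hΛ0 : 0 ≤ A * Real.log (Real.log (Real.log (x : ℝ))) ^ ((k : ℝ) * ((-1 : ℂ).re - 1)) *
      Real.exp (C * ‖(-1 : ℂ) - 1‖ * Real.log (‖(-1 : ℂ) - 1‖ + 2)) := (norm_nonneg _).trans hΛ
  have hXle : ((x + 1 - m₀ : ℕ) : ℝ) ≤ (x : ℝ) + 1 := by exact_mod_cast Nat.sub_le (x + 1) m₀
  have hxnn : (0 : ℝ) ≤ x := Nat.cast_nonneg x
  have h8 := (htri'.trans (add_le_add hE hsq)).trans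
    (add_le_add h3 (add_le_add h4 ((mul_le_mul_of_nonneg_right hXle hΛ0).trans h5)))
  linarith

/-! ### The four load-bearing theorems for S4 -/

/-- DROP `irreducible` ⇒ S4 FALSE as typed. Witness `![X ^ 2]` (`s(n²) = 2ω(n)` and the rough statistic `2ω♯(n)` are even):
`‖S_x(−1)‖ = x+1`, class sums are counts, and the squeeze `smooth_contradiction` applies (`k = 1`). [folklore] -/
theorem stubSmoothPeriodicFactorisation_false_without_irreducible :
    ¬ ∀ (k : ℕ) (f : Fin k → Polynomial ℤ), (∀ i, 0 < (f i).leadingCoeff) →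
      (Pairwise fun i j => ¬Associated (f i) (f j)) → HasNoFixedPrimeDivisor f →
      ∃ m₀ : ℕ, ∃ A C : ℝ, ∃ x₀ : ℕ, ∀ x : ℕ, x₀ ≤ x → ∀ z : ℂ, ‖z - 1‖ ≤ 3 * Real.log (Real.log (x : ℝ)) →
        ∃ (ι : Finset (ℕ × ℕ)) (c : ℕ × ℕ → ℂ),
          (∀ q ∈ ι, 0 < q.1 ∧ q.1 ∣ (∏ p ∈ Nat.primesLE ⌊Real.log (Real.log (x : ℝ))⌋₊, p ^ 2)) ∧
          ‖(∑ n ∈ Finset.range (x + 1), (z : ℂ) ^ (∑ i, (((f i).eval (n : ℤ)).toNat.factorization.sum fun _ v => min v 2))) -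
              ∑ q ∈ ι, c q * (∑ n ∈ (Finset.Ico m₀ (x + 1)).filter (fun n : ℕ => n ≡ q.2 [MOD q.1]), (z : ℂ) ^ (∑ i, (((f i).eval (n : ℤ)).toNat.factorization.sum fun p v => if Real.log (Real.log (x : ℝ)) < (p : ℝ) then min v 2 else 0)))‖ ≤
            (x : ℝ) * (Real.log (x : ℝ)) ^ ((k : ℝ) * (z.re - 1)) ∧
          ‖∑ q ∈ ι, c q / (q.1 : ℂ)‖ ≤
            A * (Real.log (Real.log (Real.log (x : ℝ)))) ^ ((k : ℝ) * (z.re - 1)) * Real.exp (C * ‖(z : ℂ) - 1‖ * Real.log (‖(z : ℂ) - 1‖ + 2)) ∧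
          ∑ q ∈ ι, ‖c q‖ / (q.1 : ℝ) ≤
            (Real.log (Real.log (Real.log (x : ℝ)))) ^ ((k : ℝ) * (‖z‖ - 1)) * Real.exp (C * (‖z‖ + 1)) := by
  intro h
  obtain ⟨m₀, A, C, x₀, hb⟩ := h 1 ![X ^ 2] (fun i => by simp) Subsingleton.pairwise
    (fun p hp => by rw [polyRootCountMod_eq_one sq_dvd_iff hp]; exact hp.one_lt)
  refine smooth_contradiction le_rfl hb (ε := 1) (by simp) (fun n => ?_) (fun x _ n => two_dvd_roughStat_sq _ n)
  rw [stat_sq, pow_mul]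
  norm_num

/-- DROP `pairwise_not_associated` ⇒ S4 FALSE as typed. Witness `![X, X]` (`s = 2s(n)`, rough statistic `2s♯(n)`), `k = 2`. [folklore] -/
theorem stubSmoothPeriodicFactorisation_false_without_pairwise_not_associated :
    ¬ ∀ (k : ℕ) (f : Fin k → Polynomial ℤ), (∀ i, Irreducible (f i)) → (∀ i, 0 < (f i).leadingCoeff) →
      HasNoFixedPrimeDivisor f →
      ∃ m₀ : ℕ, ∃ A C : ℝ, ∃ x₀ : ℕ, ∀ x : ℕ, x₀ ≤ x → ∀ z : ℂ, ‖z - 1‖ ≤ 3 * Real.log (Real.log (x : ℝ)) →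
        ∃ (ι : Finset (ℕ × ℕ)) (c : ℕ × ℕ → ℂ),
          (∀ q ∈ ι, 0 < q.1 ∧ q.1 ∣ (∏ p ∈ Nat.primesLE ⌊Real.log (Real.log (x : ℝ))⌋₊, p ^ 2)) ∧
          ‖(∑ n ∈ Finset.range (x + 1), (z : ℂ) ^ (∑ i, (((f i).eval (n : ℤ)).toNat.factorization.sum fun _ v => min v 2))) -
              ∑ q ∈ ι, c q * (∑ n ∈ (Finset.Ico m₀ (x + 1)).filter (fun n : ℕ => n ≡ q.2 [MOD q.1]), (z : ℂ) ^ (∑ i, (((f i).eval (n : ℤ)).toNat.factorization.sum fun p v => if Real.log (Real.log (x : ℝ)) < (p : ℝ) then min v 2 else 0)))‖ ≤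
            (x : ℝ) * (Real.log (x : ℝ)) ^ ((k : ℝ) * (z.re - 1)) ∧
          ‖∑ q ∈ ι, c q / (q.1 : ℂ)‖ ≤
            A * (Real.log (Real.log (Real.log (x : ℝ)))) ^ ((k : ℝ) * (z.re - 1)) * Real.exp (C * ‖(z : ℂ) - 1‖ * Real.log (‖(z : ℂ) - 1‖ + 2)) ∧
          ∑ q ∈ ι, ‖c q‖ / (q.1 : ℝ) ≤
            (Real.log (Real.log (Real.log (x : ℝ)))) ^ ((k : ℝ) * (‖z‖ - 1)) * Real.exp (C * (‖z‖ + 1)) := by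
  intro h
  obtain ⟨m₀, A, C, x₀, hb⟩ := h 2 ![X, X]
    (fun i => by fin_cases i <;> simpa using Polynomial.prime_X.irreducible)
    (fun i => by fin_cases i <;> simp)
    (fun p hp => by rw [polyRootCountMod_eq_one pair_dvd_iff hp]; exact hp.one_lt)
  refine smooth_contradiction (by norm_num) hb (ε := 1) (by simp) (fun n => ?_)
    (fun x _ n => two_dvd_roughStat_pair _ n)
  rw [stat_pair, pow_mul]
  norm_num

/-- DROP `leadingCoeff_pos` ⇒ S4 FALSE as typed. Witness `![-X]`: `Int.toNat` kills every value, both statistics vanish,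
`S_x(z) = x+1` for every `z`; squeeze at `z = −1`. [folklore] -/
theorem stubSmoothPeriodicFactorisation_false_without_leadingCoeff_pos :
    ¬ ∀ (k : ℕ) (f : Fin k → Polynomial ℤ), (∀ i, Irreducible (f i)) →
      (Pairwise fun i j => ¬Associated (f i) (f j)) → HasNoFixedPrimeDivisor f →
      ∃ m₀ : ℕ, ∃ A C : ℝ, ∃ x₀ : ℕ, ∀ x : ℕ, x₀ ≤ x → ∀ z : ℂ, ‖z - 1‖ ≤ 3 * Real.log (Real.log (x : ℝ)) →
        ∃ (ι : Finset (ℕ × ℕ)) (c : ℕ × ℕ → ℂ),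
          (∀ q ∈ ι, 0 < q.1 ∧ q.1 ∣ (∏ p ∈ Nat.primesLE ⌊Real.log (Real.log (x : ℝ))⌋₊, p ^ 2)) ∧
          ‖(∑ n ∈ Finset.range (x + 1), (z : ℂ) ^ (∑ i, (((f i).eval (n : ℤ)).toNat.factorization.sum fun _ v => min v 2))) -
              ∑ q ∈ ι, c q * (∑ n ∈ (Finset.Ico m₀ (x + 1)).filter (fun n : ℕ => n ≡ q.2 [MOD q.1]), (z : ℂ) ^ (∑ i, (((f i).eval (n : ℤ)).toNat.factorization.sum fun p v => if Real.log (Real.log (x : ℝ)) < (p : ℝ) then min v 2 else 0)))‖ ≤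
            (x : ℝ) * (Real.log (x : ℝ)) ^ ((k : ℝ) * (z.re - 1)) ∧
          ‖∑ q ∈ ι, c q / (q.1 : ℂ)‖ ≤
            A * (Real.log (Real.log (Real.log (x : ℝ)))) ^ ((k : ℝ) * (z.re - 1)) * Real.exp (C * ‖(z : ℂ) - 1‖ * Real.log (‖(z : ℂ) - 1‖ + 2)) ∧
          ∑ q ∈ ι, ‖c q‖ / (q.1 : ℝ) ≤
            (Real.log (Real.log (Real.log (x : ℝ)))) ^ ((k : ℝ) * (‖z‖ - 1)) * Real.exp (C * (‖z‖ + 1)) := by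
  intro h
  obtain ⟨m₀, A, C, x₀, hb⟩ := h 1 ![-X] (fun i => by simpa using Polynomial.prime_X.neg.irreducible)
    Subsingleton.pairwise (fun p hp => by rw [polyRootCountMod_eq_one negX_dvd_iff hp]; exact hp.one_lt)
  refine smooth_contradiction le_rfl hb (ε := 1) (by simp) (fun n => ?_)
    (fun x _ n => by rw [roughStat_negX]; exact dvd_zero 2)
  rw [stat_negX, pow_zero]

/-- DROP `hasNoFixedPrimeDivisor` ⇒ S4 FALSE as typed — through the CONSTANT prime `![C 3]` (irreducible in `ℤ[X]`,
leading coefficient `3`, pairwise vacuous): `s_f ≡ 1`, so `S_x(−1) = −(x+1)`; for `log log x ≥ 3` the prime `3` is smooth and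
the rough statistic vanishes; squeeze at `z = −1`. [folklore] -/
theorem stubSmoothPeriodicFactorisation_false_without_hasNoFixedPrimeDivisor :
    ¬ ∀ (k : ℕ) (f : Fin k → Polynomial ℤ), (∀ i, Irreducible (f i)) → (∀ i, 0 < (f i).leadingCoeff) →
      (Pairwise fun i j => ¬Associated (f i) (f j)) →
      ∃ m₀ : ℕ, ∃ A C : ℝ, ∃ x₀ : ℕ, ∀ x : ℕ, x₀ ≤ x → ∀ z : ℂ, ‖z - 1‖ ≤ 3 * Real.log (Real.log (x : ℝ)) →
        ∃ (ι : Finset (ℕ × ℕ)) (c : ℕ × ℕ → ℂ),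
          (∀ q ∈ ι, 0 < q.1 ∧ q.1 ∣ (∏ p ∈ Nat.primesLE ⌊Real.log (Real.log (x : ℝ))⌋₊, p ^ 2)) ∧
          ‖(∑ n ∈ Finset.range (x + 1), (z : ℂ) ^ (∑ i, (((f i).eval (n : ℤ)).toNat.factorization.sum fun _ v => min v 2))) -
              ∑ q ∈ ι, c q * (∑ n ∈ (Finset.Ico m₀ (x + 1)).filter (fun n : ℕ => n ≡ q.2 [MOD q.1]), (z : ℂ) ^ (∑ i, (((f i).eval (n : ℤ)).toNat.factorization.sum fun p v => if Real.log (Real.log (x : ℝ)) < (p : ℝ) then min v 2 else 0)))‖ ≤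
            (x : ℝ) * (Real.log (x : ℝ)) ^ ((k : ℝ) * (z.re - 1)) ∧
          ‖∑ q ∈ ι, c q / (q.1 : ℂ)‖ ≤
            A * (Real.log (Real.log (Real.log (x : ℝ)))) ^ ((k : ℝ) * (z.re - 1)) * Real.exp (C * ‖(z : ℂ) - 1‖ * Real.log (‖(z : ℂ) - 1‖ + 2)) ∧
          ∑ q ∈ ι, ‖c q‖ / (q.1 : ℝ) ≤
            (Real.log (Real.log (Real.log (x : ℝ)))) ^ ((k : ℝ) * (‖z‖ - 1)) * Real.exp (C * (‖z‖ + 1)) := by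
  intro h
  obtain ⟨hirr, hlc, hpw⟩ := C_three_other_fields
  obtain ⟨m₀, A, C', x₀, hb⟩ := h 1 ![(C 3 : ℤ[X])] hirr hlc hpw
  refine smooth_contradiction le_rfl hb (ε := -1) (by simp) (fun n => ?_)
    (fun x hx n => by rw [roughStat_C_three hx]; exact dvd_zero 2)
  rw [stat_C_three, pow_one]

end Summit.Parity.BatemanHorn.Theorems.SystemZeroRepulsion.Negative
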